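import Literature.AlgebraicGeometry.Frobenioids.ArchimedeanFSMFFComplexRegime
import Literature.AlgebraicGeometry.Frobenioids.ArchimedeanFSMRegime
import HarnessLib

/-!
# Frobenioids II, Proposition 3.4 (viii), repaired reading: NON-VACUITY — the base `D₀[ℂ] ↪ D₀`
# (abc-iut cell, layer L1, node `FrdII:Prop3.4(viii)`, sub-DAG `plan/L1/SUBDAG-FrdII-Prop34.md` row P34-L00)

Mochizuki, *The geometry of Frobenioids II: poly-Frobenioids*, Kyushu J. Math. **62** (2008)
401–460, §3, Proposition 3.4 (viii) p. 30 [cite: MochizukiFrdII2008, Prop 3.4 (viii) p.30].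

PROOF-ONLY file (nothing is defined). The typed item `ArchFrd.Prop34_viii π` (abc-iut-L1-t6,
`ArchimedeanFSM.lean`, arbitrary base `π : D ⥤ D₀`) is REFUTED as typed at `π = 𝟭 D₀`
(`ArchFrd.not_prop34_viii_id`, abc-iut-L1-d3) and PROVED under the cell's repaired reading — complex
regime, `D` totally epimorphic (standing hypothesis of Ex. 3.3 (i)), `D` of FSMFF-type in the author's
revised (2024) sense — as `ArchFrd.prop34_viii_of_isComplex` (`ArchimedeanFSMFFComplexRegime.lean`,
abc-iut-w5-d152). This file shows that the repaired reading is EXERCISED, not vacuous: the full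
subcategory `D₀[ℂ] ⊂ D₀` on `Spec ℂ` (arrows `Gal(ℂ/ℝ)`), with its inclusion as structure functor,
satisfies all three hypotheses, so Prop. 3.4 (viii) holds for it AS TYPED — while it fails for `D₀`
itself. No side is taken on [IUTchIII] Cor. 3.12.
-/

namespace Literature.AlgebraicGeometry.Frobenioids

open CategoryTheory

noncomputable section

namespace ArchFrd

/-- The inclusion `D₀[ℂ] ↪ D₀` of the full subcategory on `Spec ℂ` is in the complex regime
(tautologically). [cite: MochizukiFrdII2008, Def 3.1 (v) p.24] -/
theorem isComplexRegime_complexPart :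
    IsComplexRegime (ObjectProperty.ι (D0.IsComplex : ObjectProperty D0)) := fun d => d.property

/-- `D₀[ℂ]` is totally epimorphic (a full subcategory of the totally epimorphic `D₀`).
[cite: MochizukiFrdII2008, §3 p.23] -/
theorem isTotallyEpimorphic_complexPart :
    IsTotallyEpimorphic (ObjectProperty.FullSubcategory (D0.IsComplex : ObjectProperty D0)) := by
  refine ⟨fun {X Y} f => ⟨fun {Z} g h e => ?_⟩⟩
  haveI := D0.isTotallyEpimorphic.epi f.hom
  exact InducedCategory.hom_ext ((cancel_epi f.hom).mp (congrArg InducedCategory.Hom.hom e))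

/-- `D₀[ℂ]` is of FSM-type: all its arrows (`Gal(ℂ/ℝ)`) are isomorphisms.
[cite: MochizukiFrdII2008, §3 p.23] -/
theorem isOfFSMType_complexPart :
    IsOfFSMType (ObjectProperty.FullSubcategory (D0.IsComplex : ObjectProperty D0)) :=
  ⟨fun {X Y} f _ => by
    haveI : IsIso f.hom := D0.isIso_of_isComplex f.hom X.property Y.property
    exact (ObjectProperty.isIso_hom_iff f).mp inferInstance⟩

/-- `D₀[ℂ]` is of FSMFF-type in the revised (2024) sense (it is of FSM-type).
[cite: MochizukiFrdII2008, §3 p.23] -/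
theorem isOfFSMFFType2024_complexPart :
    IsOfFSMFFType2024 (ObjectProperty.FullSubcategory (D0.IsComplex : ObjectProperty D0)) :=
  isOfFSMType_complexPart.isOfFSMFFType2024

/-- **Non-vacuity of the repaired reading of Prop. 3.4 (viii)**: the typed item — all three towers
`A`, `N`, `R` — HOLDS for the base `D₀[ℂ] ↪ D₀` (whereas it fails for `D₀`, `ArchFrd.not_prop34_viii_id`).
[cite: MochizukiFrdII2008, Prop 3.4 (viii) p.30] -/
theorem prop34_viii_complexPart : Prop34_viii (ObjectProperty.ι (D0.IsComplex : ObjectProperty D0)) :=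
  prop34_viii_of_isComplex _ isComplexRegime_complexPart isTotallyEpimorphic_complexPart
    isOfFSMFFType2024_complexPart

end ArchFrd

end

end Literature.AlgebraicGeometry.Frobenioids
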